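import Literature.Analysis.FluidPDE.TaoCascadeDuhamelRestart
import HarnessLib

/-!
# Tao's cascade equation: the lifted Volterra operator on weighted balls (Picard estimates)

T. Tao, *Finite time blowup for an averaged three-dimensional Navier–Stokes equation*,
J. Amer. Math. Soc. **29** (2016), 601–674 = arXiv:1402.0290v3, §4, Lemma 4.1 (4.8), (4.14).

Read mode by mode, the mild form (4.14) of the cascade equation (3.3) with datum `A ψ_{i₀,n₀}` is the LIFTED
VOLTERRA SYSTEM `X_{i,n}(t) = 𝒱[X]_{i,n}(t) := ∫ φ[X]_{i,n}(ξ,t) |ψ̂_{i,n}(ξ)|² dξ` for the wavelet coefficients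
`X : Fin m → ℤ → ℝ → ℝ`, where `φ[X]_{i,n}(ξ,t) = duhamelScalar δ_{i,n} Q[X]_{i,n} (4π²|ξ|²) t` is the heat fibre
with datum `δ_{i,n} = A·1_{(i,n)=(i₀,n₀)}` (`modeDelta`) driven by `Q[X]_{i,n}(s) = quadTerm_{i,n}(X(max(s,0)))`.
This file proves the two estimates of the Picard scheme for `𝒱` in the weighted space
`‖X‖_W = sup_{i,n} w_n |X_{i,n}|`, `w_n = 1 + (1+ε₀)^{10n}` (the weight of the a priori bound (4.5)):

* `abs_quadTerm_sub_le`, `weight_mul_abs_quadTerm_sub_le`, `weight_mul_abs_quadTerm_le`: the circuit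
  nonlinearity is Lipschitz and bounded on `W`-balls, `w_n|Q_n(X) - Q_n(Y)| ≤ 2²²K_α R ‖X-Y‖_W`,
  `w_n|Q_n(X)| ≤ 2²²K_α R²` (`K_α = ∑|α|`; neighbouring scales have comparable weights and
  `(1+ε₀)^{5n/2} w_n / w_{n-1}² = O(1)`);
* `volterra_abs_le` (self-map) and `volterra_sub_le` (contraction) on a time slab `[T,T']` for coefficient families
  with a common history on `[0,T]`, from the restart estimates of `TaoCascadeDuhamelRestart.lean`;
* `volterra_unique`, `volterra_unique_Ico`: two continuous solutions on `[0,T]` (on `[0,S)`) with weighted bounds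
  (on every `[0,S']`, `S' < S`) coincide (the contraction estimate on consecutive blocks of length `τ` halves every
  bound of the difference).

## References

* T. Tao, J. Amer. Math. Soc. 29 (2016), 601–674, arXiv:1402.0290v3, §4 Lemma 4.1 (4.5), (4.8), (4.14). Key `Tao2016AveragedNS`.
-/

noncomputable section

open MeasureTheory Set Filter Metric
open scoped Topology

namespace Literature.Analysis.FluidPDE.Tao2016

variable {ε₀ : ℝ} {m : ℕ}

/-! ## The circuit nonlinearity on weighted balls -/

/-- `c² + c³ ≤ 2(1 + c¹⁰)` for `c > 0`. [folklore] -/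
theorem sq_add_cube_le {c : ℝ} (hc : 0 < c) : c ^ 2 + c ^ 3 ≤ 2 * (1 + c ^ 10) := by
  rcases le_or_gt c 1 with h | h
  · have h2 : c ^ 2 ≤ 1 := pow_le_one₀ hc.le h
    have h3 : c ^ 3 ≤ 1 := pow_le_one₀ hc.le h
    nlinarith [pow_nonneg hc.le 10]
  · have h2 : c ^ 2 ≤ c ^ 10 := pow_le_pow_right₀ h.le (by norm_num)
    have h3 : c ^ 3 ≤ c ^ 10 := pow_le_pow_right₀ h.le (by norm_num)
    linarith

/-- The weighted fibre coefficient is bounded: `(1+c¹⁰) · K (c²+c³) (2¹⁰/(1+c¹⁰))² M ≤ 2²¹ K M`. [folklore] -/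
theorem weight_mul_fibreCoeff_le {c K M : ℝ} (hc : 0 < c) (hK : 0 ≤ K) (hM : 0 ≤ M) :
    (1 + c ^ 10) * (K * ((c ^ 2 + c ^ 3) * ((2 ^ 10 / (1 + c ^ 10)) ^ 2 * M))) ≤ 2 ^ 21 * K * M := by
  have hw : 0 < 1 + c ^ 10 := by positivity
  have key : (c ^ 2 + c ^ 3) * (2 ^ 10 / (1 + c ^ 10)) ^ 2 ≤ 2 ^ 21 / (1 + c ^ 10) := by
    rw [div_pow, ← mul_div_assoc, div_le_div_iff₀ (by positivity) hw]
    nlinarith [sq_add_cube_le hc, hw]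
  calc (1 + c ^ 10) * (K * ((c ^ 2 + c ^ 3) * ((2 ^ 10 / (1 + c ^ 10)) ^ 2 * M)))
      = (1 + c ^ 10) * (K * M) * ((c ^ 2 + c ^ 3) * (2 ^ 10 / (1 + c ^ 10)) ^ 2) := by ring
    _ ≤ (1 + c ^ 10) * (K * M) * (2 ^ 21 / (1 + c ^ 10)) := mul_le_mul_of_nonneg_left key (by positivity)
    _ = 2 ^ 21 * K * M := by field_simp

/-- **Lipschitz bound of the circuit nonlinearity on a weighted ball**: from
`w_k|X_{j,k}(s)|, w_k|Y_{j,k}(s)| ≤ R` and `w_k|X_{j,k}(s) - Y_{j,k}(s)| ≤ D` (`w_k = 1+(1+ε₀)^{10k}`),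
`|quadTerm_{i,n}(X(s)) - quadTerm_{i,n}(Y(s))| ≤ K_α ((1+ε₀)^{2n}+(1+ε₀)^{3n}) (2¹⁰/w_n)² · 2RD`
(`X₁X₂ - Y₁Y₂ = (X₁-Y₁)X₂ + Y₁(X₂-Y₂)`, the shifts move the scale by at most one). [cite: Tao2016AveragedNS, §4 (4.8)] -/
theorem abs_quadTerm_sub_le (hε₀ : 0 < ε₀) (hε₁ : ε₀ < 1) (α : Fin m → Fin m → Fin m → ℤ × ℤ × ℤ → ℝ)
    (X Y : Fin m → ℤ → ℝ → ℝ) {R D s : ℝ}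
    (hX : ∀ (j : Fin m) (k : ℤ), (1 + ((1 + ε₀) ^ k) ^ 10) * |X j k s| ≤ R)
    (hY : ∀ (j : Fin m) (k : ℤ), (1 + ((1 + ε₀) ^ k) ^ 10) * |Y j k s| ≤ R)
    (hD : ∀ (j : Fin m) (k : ℤ), (1 + ((1 + ε₀) ^ k) ^ 10) * |X j k s - Y j k s| ≤ D) (i : Fin m) (n : ℤ) :
    |TaoCascade.quadTerm ε₀ α X i n s - TaoCascade.quadTerm ε₀ α Y i n s| ≤
      (∑ i₃ : Fin m, ∑ i₁ : Fin m, ∑ i₂ : Fin m, ∑ μ ∈ TaoCascade.shiftSet, |α i₁ i₂ i₃ μ|) *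
        ((((1 + ε₀) ^ n) ^ 2 + ((1 + ε₀) ^ n) ^ 3) * ((2 ^ 10 / (1 + ((1 + ε₀) ^ n) ^ 10)) ^ 2 * (2 * R * D))) := by
  set a : ℝ := 1 + ε₀ with ha
  have ha0 : 0 < a := by rw [ha]; linarith
  have ha1 : 1 ≤ a := by rw [ha]; linarith
  have ha2 : a ≤ 2 := by rw [ha]; linarith
  set c : ℝ := a ^ n with hc
  have hc0 : 0 < c := zpow_pos ha0 n
  set w : ℝ := 1 + c ^ 10 with hw
  have hw0 : 0 < w := by positivity
  have hR0 : 0 ≤ R := le_trans (by positivity) (hX i n)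
  have hD0 : 0 ≤ D := le_trans (by positivity) (hD i n)
  -- values at the shifted scales
  have hb : ∀ (F : Fin m → ℤ → ℝ → ℝ) (C : ℝ), 0 ≤ C → (∀ (j : Fin m) (k : ℤ), (1 + (a ^ k) ^ 10) * |F j k s| ≤ C) →
      ∀ (j : Fin m) (k : ℤ), n ≤ k + 1 → |F j k s| ≤ 2 ^ 10 / w * C := by
    intro F C hC0 hF j k hk
    have hwk : 0 < 1 + (a ^ k) ^ 10 := by positivity
    have h1 : |F j k s| ≤ C / (1 + (a ^ k) ^ 10) := by
      rw [le_div_iff₀ hwk, mul_comm]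
      exact hF j k
    refine h1.trans ?_
    rw [div_mul_eq_mul_div, div_le_div_iff₀ hwk hw0]
    -- neighbouring scales have comparable weights: `w = 1 + a^{10n} ≤ 2^{10}(1 + a^{10k})` for `n ≤ k + 1`
    have hak : (a ^ n) ^ 10 ≤ (a ^ k) ^ 10 * 2 ^ 10 := by
      calc (a ^ n) ^ 10 ≤ (a ^ k * a) ^ 10 := pow_le_pow_left₀ (zpow_nonneg ha0.le _)
            ((zpow_le_zpow_right₀ ha1 hk).trans_eq (zpow_add_one₀ ha0.ne' k)) 10
        _ = (a ^ k) ^ 10 * a ^ 10 := mul_pow _ _ _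
        _ ≤ (a ^ k) ^ 10 * 2 ^ 10 := by gcongr
    have hwk' : w ≤ 2 ^ 10 * (1 + (a ^ k) ^ 10) := by rw [hw, hc]; nlinarith [pow_nonneg (zpow_nonneg ha0.le k) 10]
    calc C * w ≤ C * (2 ^ 10 * (1 + (a ^ k) ^ 10)) := mul_le_mul_of_nonneg_left hwk' hC0
      _ = 2 ^ 10 * C * (1 + (a ^ k) ^ 10) := by ring
  have hpow : ∀ μ₃ : ℤ, 0 ≤ μ₃ → a ^ ((5 : ℝ) * ((n : ℝ) - (μ₃ : ℝ)) / 2) ≤ c ^ 2 + c ^ 3 := by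
    intro μ₃ hμ₃
    have hμ₃' : (0 : ℝ) ≤ μ₃ := by exact_mod_cast hμ₃
    calc a ^ ((5 : ℝ) * ((n : ℝ) - (μ₃ : ℝ)) / 2) ≤ a ^ ((n : ℝ) * (5 / 2)) :=
          Real.rpow_le_rpow_of_exponent_le ha1 (by linarith)
      _ = c ^ ((5 : ℝ) / 2) := by rw [Real.rpow_mul ha0.le, Real.rpow_intCast]
      _ ≤ c ^ 2 + c ^ 3 := by
          -- `c^{5/2} ≤ c² + c³`
          rcases le_or_gt 1 c with h1 | h1
          · calc c ^ ((5 : ℝ) / 2) ≤ c ^ ((3 : ℕ) : ℝ) := Real.rpow_le_rpow_of_exponent_le h1 (by norm_num)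
              _ = c ^ 3 := Real.rpow_natCast c 3
              _ ≤ c ^ 2 + c ^ 3 := by nlinarith [pow_pos hc0 2]
          · calc c ^ ((5 : ℝ) / 2) ≤ c ^ ((2 : ℕ) : ℝ) := Real.rpow_le_rpow_of_exponent_ge hc0 h1.le (by norm_num)
              _ = c ^ 2 := Real.rpow_natCast c 2
              _ ≤ c ^ 2 + c ^ 3 := by nlinarith [pow_pos hc0 3]
  have hshift : ∀ μ ∈ TaoCascade.shiftSet,
      0 ≤ μ.2.2 ∧ n ≤ (n - μ.2.2 + μ.1) + 1 ∧ n ≤ (n - μ.2.2 + μ.2.1) + 1 := by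
    intro μ hμ
    rcases (TaoCascade.mem_shiftSet_iff μ).1 hμ with rfl | rfl | rfl | rfl <;> simp <;> omega
  -- termwise
  have hterm : ∀ (i₁ i₂ : Fin m), ∀ μ ∈ TaoCascade.shiftSet,
      |α i₁ i₂ i μ * a ^ ((5 : ℝ) * ((n : ℝ) - (μ.2.2 : ℝ)) / 2) *
          (X i₁ (n - μ.2.2 + μ.1) s * X i₂ (n - μ.2.2 + μ.2.1) s -
            Y i₁ (n - μ.2.2 + μ.1) s * Y i₂ (n - μ.2.2 + μ.2.1) s)| ≤
        |α i₁ i₂ i μ| * ((c ^ 2 + c ^ 3) * ((2 ^ 10 / w) ^ 2 * (2 * R * D))) := by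
    intro i₁ i₂ μ hμ
    obtain ⟨hμ₃, hk₁, hk₂⟩ := hshift μ hμ
    rw [abs_mul, abs_mul, abs_of_pos (Real.rpow_pos_of_pos ha0 _), mul_assoc]
    refine mul_le_mul_of_nonneg_left (mul_le_mul (hpow μ.2.2 hμ₃) ?_ (abs_nonneg _) (by positivity)) (abs_nonneg _)
    have h1 := hb (fun j k s => X j k s - Y j k s) D hD0 hD i₁ _ hk₁
    have h2 := hb X R hR0 hX i₂ _ hk₂
    have h3 := hb Y R hR0 hY i₁ _ hk₁
    have h4 := hb (fun j k s => X j k s - Y j k s) D hD0 hD i₂ _ hk₂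
    rw [show X i₁ (n - μ.2.2 + μ.1) s * X i₂ (n - μ.2.2 + μ.2.1) s - Y i₁ (n - μ.2.2 + μ.1) s * Y i₂ (n - μ.2.2 + μ.2.1) s =
      (X i₁ (n - μ.2.2 + μ.1) s - Y i₁ (n - μ.2.2 + μ.1) s) * X i₂ (n - μ.2.2 + μ.2.1) s +
        Y i₁ (n - μ.2.2 + μ.1) s * (X i₂ (n - μ.2.2 + μ.2.1) s - Y i₂ (n - μ.2.2 + μ.2.1) s) by ring]
    refine (abs_add_le _ _).trans ?_
    rw [abs_mul, abs_mul]
    calc |X i₁ (n - μ.2.2 + μ.1) s - Y i₁ (n - μ.2.2 + μ.1) s| * |X i₂ (n - μ.2.2 + μ.2.1) s| +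
          |Y i₁ (n - μ.2.2 + μ.1) s| * |X i₂ (n - μ.2.2 + μ.2.1) s - Y i₂ (n - μ.2.2 + μ.2.1) s|
        ≤ 2 ^ 10 / w * D * (2 ^ 10 / w * R) + 2 ^ 10 / w * R * (2 ^ 10 / w * D) :=
          add_le_add (mul_le_mul h1 h2 (abs_nonneg _) (by positivity)) (mul_le_mul h3 h4 (abs_nonneg _) (by positivity))
      _ = (2 ^ 10 / w) ^ 2 * (2 * R * D) := by ring
  have hK : 0 ≤ (c ^ 2 + c ^ 3) * ((2 ^ 10 / w) ^ 2 * (2 * R * D)) := by positivity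
  have hdiff : TaoCascade.quadTerm ε₀ α X i n s - TaoCascade.quadTerm ε₀ α Y i n s =
      ∑ i₁ : Fin m, ∑ i₂ : Fin m, ∑ μ ∈ TaoCascade.shiftSet, α i₁ i₂ i μ * a ^ ((5 : ℝ) * ((n : ℝ) - (μ.2.2 : ℝ)) / 2) *
        (X i₁ (n - μ.2.2 + μ.1) s * X i₂ (n - μ.2.2 + μ.2.1) s -
          Y i₁ (n - μ.2.2 + μ.1) s * Y i₂ (n - μ.2.2 + μ.2.1) s) := by
    simp only [TaoCascade.quadTerm, ← Finset.sum_sub_distrib, ← mul_sub, ha]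
  rw [hdiff]
  calc |∑ i₁ : Fin m, ∑ i₂ : Fin m, ∑ μ ∈ TaoCascade.shiftSet, α i₁ i₂ i μ * a ^ ((5 : ℝ) * ((n : ℝ) - (μ.2.2 : ℝ)) / 2) *
          (X i₁ (n - μ.2.2 + μ.1) s * X i₂ (n - μ.2.2 + μ.2.1) s -
            Y i₁ (n - μ.2.2 + μ.1) s * Y i₂ (n - μ.2.2 + μ.2.1) s)|
      ≤ ∑ i₁ : Fin m, ∑ i₂ : Fin m, ∑ μ ∈ TaoCascade.shiftSet, |α i₁ i₂ i μ * a ^ ((5 : ℝ) * ((n : ℝ) - (μ.2.2 : ℝ)) / 2) *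
          (X i₁ (n - μ.2.2 + μ.1) s * X i₂ (n - μ.2.2 + μ.2.1) s -
            Y i₁ (n - μ.2.2 + μ.1) s * Y i₂ (n - μ.2.2 + μ.2.1) s)| := by
        refine (Finset.abs_sum_le_sum_abs _ _).trans (Finset.sum_le_sum fun i₁ _ => ?_)
        refine (Finset.abs_sum_le_sum_abs _ _).trans (Finset.sum_le_sum fun i₂ _ => ?_)
        exact Finset.abs_sum_le_sum_abs _ _
    _ ≤ ∑ i₁ : Fin m, ∑ i₂ : Fin m, ∑ μ ∈ TaoCascade.shiftSet,
          |α i₁ i₂ i μ| * ((c ^ 2 + c ^ 3) * ((2 ^ 10 / w) ^ 2 * (2 * R * D))) :=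
        Finset.sum_le_sum fun i₁ _ => Finset.sum_le_sum fun i₂ _ => Finset.sum_le_sum fun μ hμ => hterm i₁ i₂ μ hμ
    _ = (∑ i₁ : Fin m, ∑ i₂ : Fin m, ∑ μ ∈ TaoCascade.shiftSet, |α i₁ i₂ i μ|) *
          ((c ^ 2 + c ^ 3) * ((2 ^ 10 / w) ^ 2 * (2 * R * D))) := by
        simp only [Finset.sum_mul]
    _ ≤ (∑ i₃ : Fin m, ∑ i₁ : Fin m, ∑ i₂ : Fin m, ∑ μ ∈ TaoCascade.shiftSet, |α i₁ i₂ i₃ μ|) *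
          ((c ^ 2 + c ^ 3) * ((2 ^ 10 / w) ^ 2 * (2 * R * D))) := by
        refine mul_le_mul_of_nonneg_right ?_ hK
        exact Finset.single_le_sum
          (f := fun i₃ : Fin m => ∑ i₁ : Fin m, ∑ i₂ : Fin m, ∑ μ ∈ TaoCascade.shiftSet, |α i₁ i₂ i₃ μ|)
          (fun _ _ => by positivity) (Finset.mem_univ i)

/-- **Weighted Lipschitz bound of the forcing**: `w_n |quadTerm_{i,n}(X(s)) - quadTerm_{i,n}(Y(s))| ≤ 2²² K_α R D`. [cite: Tao2016AveragedNS, §4 (4.8)] -/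
theorem weight_mul_abs_quadTerm_sub_le (hε₀ : 0 < ε₀) (hε₁ : ε₀ < 1) (α : Fin m → Fin m → Fin m → ℤ × ℤ × ℤ → ℝ)
    (X Y : Fin m → ℤ → ℝ → ℝ) {R D s : ℝ}
    (hX : ∀ (j : Fin m) (k : ℤ), (1 + ((1 + ε₀) ^ k) ^ 10) * |X j k s| ≤ R)
    (hY : ∀ (j : Fin m) (k : ℤ), (1 + ((1 + ε₀) ^ k) ^ 10) * |Y j k s| ≤ R)
    (hD : ∀ (j : Fin m) (k : ℤ), (1 + ((1 + ε₀) ^ k) ^ 10) * |X j k s - Y j k s| ≤ D) (i : Fin m) (n : ℤ) :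
    (1 + ((1 + ε₀) ^ n) ^ 10) * |TaoCascade.quadTerm ε₀ α X i n s - TaoCascade.quadTerm ε₀ α Y i n s| ≤
      2 ^ 22 * (∑ i₃ : Fin m, ∑ i₁ : Fin m, ∑ i₂ : Fin m, ∑ μ ∈ TaoCascade.shiftSet, |α i₁ i₂ i₃ μ|) * R * D := by
  have hR0 : 0 ≤ R := le_trans (by positivity) (hX i n)
  have hD0 : 0 ≤ D := le_trans (by positivity) (hD i n)
  have h := (mul_le_mul_of_nonneg_left (abs_quadTerm_sub_le hε₀ hε₁ α X Y hX hY hD i n) (by positivity)).trans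
    (weight_mul_fibreCoeff_le (zpow_pos (by linarith) n) (by positivity) (by positivity : (0 : ℝ) ≤ 2 * R * D))
  linarith

/-- The circuit nonlinearity of the zero family vanishes. [folklore] -/
theorem quadTerm_zero (α : Fin m → Fin m → Fin m → ℤ × ℤ × ℤ → ℝ) (i : Fin m) (n : ℤ) (s : ℝ) :
    TaoCascade.quadTerm ε₀ α (fun _ _ _ => (0 : ℝ)) i n s = 0 := by
  simp [TaoCascade.quadTerm]

/-- **Weighted size bound of the forcing**: `w_n |quadTerm_{i,n}(X(s))| ≤ 2²² K_α R²` on the `W`-ball of radius `R`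
(the Lipschitz bound against the zero family). [cite: Tao2016AveragedNS, §4 (4.8)] -/
theorem weight_mul_abs_quadTerm_le (hε₀ : 0 < ε₀) (hε₁ : ε₀ < 1) (α : Fin m → Fin m → Fin m → ℤ × ℤ × ℤ → ℝ)
    (X : Fin m → ℤ → ℝ → ℝ) {R s : ℝ} (hX : ∀ (j : Fin m) (k : ℤ), (1 + ((1 + ε₀) ^ k) ^ 10) * |X j k s| ≤ R)
    (i : Fin m) (n : ℤ) :
    (1 + ((1 + ε₀) ^ n) ^ 10) * |TaoCascade.quadTerm ε₀ α X i n s| ≤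
      2 ^ 22 * (∑ i₃ : Fin m, ∑ i₁ : Fin m, ∑ i₂ : Fin m, ∑ μ ∈ TaoCascade.shiftSet, |α i₁ i₂ i₃ μ|) * R * R := by
  have hR0 : 0 ≤ R := le_trans (by positivity) (hX i n)
  have h := weight_mul_abs_quadTerm_sub_le hε₀ hε₁ α X (fun _ _ _ => (0 : ℝ)) hX
    (fun j k => by rw [abs_zero, mul_zero]; exact hR0) (fun j k => by rw [sub_zero]; exact hX j k) i n
  rwa [quadTerm_zero, sub_zero] at h

/-! ## The Volterra operator: self-map and contraction estimates -/
set_option maxHeartbeats 400000 in -- buildfix (bf3-g27): 160k/180k FAIL, 200k PASS at accept time; line-neutral budget line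
/-- **Self-map estimate.** If `X` is continuous with `w_k|X_{j,k}| ≤ B` on `[0,T]` and `≤ R` on `[0,T']`, then for
`t ∈ [T,T']`: `w_n |𝒱[X]_{i,n}(t)| ≤ w_{n₀}|A| + 2²²K_α (T B² + (T'-T) R²)`. [cite: Tao2016AveragedNS, §4 Lemma 4.1 (4.14)] -/
theorem volterra_abs_le (hε₀ : 0 < ε₀) (hε₁ : ε₀ < 1) (𝒟 : CascadeWaveletData ε₀ m)
    (α : Fin m → Fin m → Fin m → ℤ × ℤ × ℤ → ℝ) (i₀ : Fin m) (n₀ : ℤ) (A : ℝ) {X : Fin m → ℤ → ℝ → ℝ}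
    (hXc : ∀ (j : Fin m) (k : ℤ), Continuous (X j k)) {T T' B R : ℝ} (hT : 0 ≤ T) (hTT' : T ≤ T')
    (hB : ∀ (j : Fin m) (k : ℤ), ∀ s ∈ Icc 0 T, (1 + ((1 + ε₀) ^ k) ^ 10) * |X j k s| ≤ B)
    (hR : ∀ (j : Fin m) (k : ℤ), ∀ s ∈ Icc 0 T', (1 + ((1 + ε₀) ^ k) ^ 10) * |X j k s| ≤ R)
    (i : Fin m) (n : ℤ) {t : ℝ} (ht : t ∈ Icc T T') :
    (1 + ((1 + ε₀) ^ n) ^ 10) * |∫ ξ : EuclideanSpace ℝ (Fin 3), duhamelScalar (A * modeDelta i₀ i n₀ n)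
        (fun s => TaoCascade.quadTerm ε₀ α X i n (max s 0)) (heatRate ξ) t * modeWeight 𝒟 i n ξ| ≤
      (1 + ((1 + ε₀) ^ n₀) ^ 10) * |A| + 2 ^ 22 *
        (∑ i₃ : Fin m, ∑ i₁ : Fin m, ∑ i₂ : Fin m, ∑ μ ∈ TaoCascade.shiftSet, |α i₁ i₂ i₃ μ|) * (T * B ^ 2 + (T' - T) * R ^ 2) := by
  set K : ℝ := ∑ i₃ : Fin m, ∑ i₁ : Fin m, ∑ i₂ : Fin m, ∑ μ ∈ TaoCascade.shiftSet, |α i₁ i₂ i₃ μ| with hK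
  have hε : 0 < 1 + ε₀ := by linarith
  have hw : 0 < 1 + ((1 + ε₀) ^ n) ^ 10 := by positivity
  have h1 : ∀ s ∈ Icc 0 T, |TaoCascade.quadTerm ε₀ α X i n (max s 0)| ≤ 2 ^ 22 * K * B * B / (1 + ((1 + ε₀) ^ n) ^ 10) := by
    intro s hs
    rw [le_div_iff₀ hw, mul_comm]
    exact weight_mul_abs_quadTerm_le hε₀ hε₁ α X (fun j k => hB j k _ ⟨le_max_right _ _, max_le hs.2 hT⟩) i n
  have h2 : ∀ s ∈ Icc T t, |TaoCascade.quadTerm ε₀ α X i n (max s 0)| ≤ 2 ^ 22 * K * R * R / (1 + ((1 + ε₀) ^ n) ^ 10) := by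
    intro s hs
    rw [le_div_iff₀ hw, mul_comm]
    exact weight_mul_abs_quadTerm_le hε₀ hε₁ α X
      (fun j k => hR j k _ ⟨le_max_right _ _, max_le (hs.2.trans ht.2) (hT.trans hTT')⟩) i n
  have h := abs_integral_duhamelScalar_le_restart (𝒟 := 𝒟) (i := i) (n := n) (δ := A * modeDelta i₀ i n₀ n) hε
    (continuous_quadTerm_clamp α hXc i n) hT ht.1 h1 h2
  have hδ : (1 + ((1 + ε₀) ^ n) ^ 10) * |A * modeDelta i₀ i n₀ n| ≤ (1 + ((1 + ε₀) ^ n₀) ^ 10) * |A| := by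
    unfold modeDelta
    split_ifs with hh
    · rw [← hh.2, mul_one]
    · rw [mul_zero, abs_zero, mul_zero]; positivity
  have hKR : 0 ≤ K * R ^ 2 := by positivity
  have hw' : (1 + ((1 + ε₀) ^ n) ^ 10) * (|A * modeDelta i₀ i n₀ n| + T * (2 ^ 22 * K * B * B / (1 + ((1 + ε₀) ^ n) ^ 10)) +
      (t - T) * (2 ^ 22 * K * R * R / (1 + ((1 + ε₀) ^ n) ^ 10))) =
      (1 + ((1 + ε₀) ^ n) ^ 10) * |A * modeDelta i₀ i n₀ n| + 2 ^ 22 * K * (T * B ^ 2 + (t - T) * R ^ 2) := by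
    rw [mul_add, mul_add, mul_left_comm _ T, mul_div_cancel₀ _ hw.ne', mul_left_comm _ (t - T), mul_div_cancel₀ _ hw.ne']
    ring
  calc (1 + ((1 + ε₀) ^ n) ^ 10) * |∫ ξ : EuclideanSpace ℝ (Fin 3), duhamelScalar (A * modeDelta i₀ i n₀ n)
          (fun s => TaoCascade.quadTerm ε₀ α X i n (max s 0)) (heatRate ξ) t * modeWeight 𝒟 i n ξ|
      ≤ (1 + ((1 + ε₀) ^ n) ^ 10) * (|A * modeDelta i₀ i n₀ n| + T * (2 ^ 22 * K * B * B / (1 + ((1 + ε₀) ^ n) ^ 10)) +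
          (t - T) * (2 ^ 22 * K * R * R / (1 + ((1 + ε₀) ^ n) ^ 10))) := mul_le_mul_of_nonneg_left h hw.le
    _ = (1 + ((1 + ε₀) ^ n) ^ 10) * |A * modeDelta i₀ i n₀ n| + 2 ^ 22 * K * (T * B ^ 2 + (t - T) * R ^ 2) := hw'
    _ ≤ (1 + ((1 + ε₀) ^ n₀) ^ 10) * |A| + 2 ^ 22 * K * (T * B ^ 2 + (T' - T) * R ^ 2) := by
        have h3 : (t - T) * R ^ 2 ≤ (T' - T) * R ^ 2 := mul_le_mul_of_nonneg_right (by linarith [ht.2]) (sq_nonneg R)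
        have h4 := mul_le_mul_of_nonneg_left h3 (by positivity : (0 : ℝ) ≤ 2 ^ 22 * K)
        linarith [hδ, h4]

/-- **Contraction estimate.** If `X, Y` are continuous with `W`-bound `R` on `[0,T']`, `w_k|X_{j,k} - Y_{j,k}| ≤ D` on
`[0,T']` and `X = Y` on `[0,T]`, then for `t ∈ [T,T']`: `w_n |𝒱[X]_{i,n}(t) - 𝒱[Y]_{i,n}(t)| ≤ (T'-T) 2²²K_α R D`. [cite: Tao2016AveragedNS, §4 Lemma 4.1 (4.14)] -/
theorem volterra_sub_le (hε₀ : 0 < ε₀) (hε₁ : ε₀ < 1) (𝒟 : CascadeWaveletData ε₀ m)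
    (α : Fin m → Fin m → Fin m → ℤ × ℤ × ℤ → ℝ) (δ : ℝ) {X Y : Fin m → ℤ → ℝ → ℝ}
    (hXc : ∀ (j : Fin m) (k : ℤ), Continuous (X j k)) (hYc : ∀ (j : Fin m) (k : ℤ), Continuous (Y j k))
    {T T' R D : ℝ} (hT : 0 ≤ T) (hTT' : T ≤ T')
    (hX : ∀ (j : Fin m) (k : ℤ), ∀ s ∈ Icc 0 T', (1 + ((1 + ε₀) ^ k) ^ 10) * |X j k s| ≤ R)
    (hY : ∀ (j : Fin m) (k : ℤ), ∀ s ∈ Icc 0 T', (1 + ((1 + ε₀) ^ k) ^ 10) * |Y j k s| ≤ R)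
    (hD : ∀ (j : Fin m) (k : ℤ), ∀ s ∈ Icc 0 T', (1 + ((1 + ε₀) ^ k) ^ 10) * |X j k s - Y j k s| ≤ D)
    (hXY : ∀ (j : Fin m) (k : ℤ), ∀ s ∈ Icc 0 T, X j k s = Y j k s) (i : Fin m) (n : ℤ) {t : ℝ} (ht : t ∈ Icc T T') :
    (1 + ((1 + ε₀) ^ n) ^ 10) *
      |(∫ ξ : EuclideanSpace ℝ (Fin 3), duhamelScalar δ
          (fun s => TaoCascade.quadTerm ε₀ α X i n (max s 0)) (heatRate ξ) t * modeWeight 𝒟 i n ξ) -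
        ∫ ξ : EuclideanSpace ℝ (Fin 3), duhamelScalar δ
          (fun s => TaoCascade.quadTerm ε₀ α Y i n (max s 0)) (heatRate ξ) t * modeWeight 𝒟 i n ξ| ≤
      (T' - T) * (2 ^ 22 * (∑ i₃ : Fin m, ∑ i₁ : Fin m, ∑ i₂ : Fin m, ∑ μ ∈ TaoCascade.shiftSet, |α i₁ i₂ i₃ μ|) * R * D) := by
  set K : ℝ := ∑ i₃ : Fin m, ∑ i₁ : Fin m, ∑ i₂ : Fin m, ∑ μ ∈ TaoCascade.shiftSet, |α i₁ i₂ i₃ μ| with hK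
  have hε : 0 < 1 + ε₀ := by linarith
  have hw : 0 < 1 + ((1 + ε₀) ^ n) ^ 10 := by positivity
  have hKRD : 0 ≤ 2 ^ 22 * K * R * D := by
    have hR0 : 0 ≤ R := le_trans (by positivity) (hX i n T ⟨hT, hTT'⟩)
    have hD0 : 0 ≤ D := le_trans (by positivity) (hD i n T ⟨hT, hTT'⟩)
    positivity
  have hC : ∀ s ∈ Icc T t, |TaoCascade.quadTerm ε₀ α X i n (max s 0) - TaoCascade.quadTerm ε₀ α Y i n (max s 0)| ≤
      2 ^ 22 * K * R * D / (1 + ((1 + ε₀) ^ n) ^ 10) := by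
    intro s hs
    rw [le_div_iff₀ hw, mul_comm]
    have hs' : max s 0 ∈ Icc 0 T' := ⟨le_max_right _ _, max_le (hs.2.trans ht.2) (hT.trans hTT')⟩
    exact weight_mul_abs_quadTerm_sub_le hε₀ hε₁ α X Y (fun j k => hX j k _ hs') (fun j k => hY j k _ hs')
      (fun j k => hD j k _ hs') i n
  have h := abs_integral_duhamelScalar_sub_le (𝒟 := 𝒟) (i := i) (n := n) (δ := δ) hε
    (continuous_quadTerm_clamp α hXc i n) (continuous_quadTerm_clamp α hYc i n) hT ht.1
    (fun s hs => quadTerm_congr α (fun j k => hXY j k _ ⟨le_max_right _ _, max_le hs.2 hT⟩) i n) hC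
  calc _ ≤ (1 + ((1 + ε₀) ^ n) ^ 10) * ((t - T) * (2 ^ 22 * K * R * D / (1 + ((1 + ε₀) ^ n) ^ 10))) :=
        mul_le_mul_of_nonneg_left h hw.le
    _ = (t - T) * (2 ^ 22 * K * R * D) := by rw [mul_left_comm, mul_div_cancel₀ _ hw.ne']
    _ ≤ (T' - T) * (2 ^ 22 * K * R * D) := mul_le_mul_of_nonneg_right (by linarith [ht.2]) hKRD

/-! ## Uniqueness on closed intervals -/

-- a double induction with many arithmetic side goals: the default heartbeat budget is too small
set_option maxHeartbeats 800000 in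
/-- **Uniqueness.** Two continuous solutions of the lifted Volterra system on `[0,T]` with weighted bounds there
coincide on `[0,T]`: on consecutive blocks of length `τ` (`τ·2²³K_α(|C|+1) ≤ 1`) the contraction estimate halves any
bound of `w_n|X_{i,n} - Y_{i,n}|`. [cite: Tao2016AveragedNS, §4 Lemma 4.1 (4.14)] -/
theorem volterra_unique (hε₀ : 0 < ε₀) (hε₁ : ε₀ < 1) (𝒟 : CascadeWaveletData ε₀ m)
    (α : Fin m → Fin m → Fin m → ℤ × ℤ × ℤ → ℝ) (i₀ : Fin m) (n₀ : ℤ) (A : ℝ) {T C : ℝ} {X Y : Fin m → ℤ → ℝ → ℝ}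
    (hXc : ∀ (i : Fin m) (n : ℤ), Continuous (X i n)) (hYc : ∀ (i : Fin m) (n : ℤ), Continuous (Y i n))
    (hXV : ∀ (i : Fin m) (n : ℤ), ∀ t ∈ Icc (0 : ℝ) T, X i n t = ∫ ξ : EuclideanSpace ℝ (Fin 3),
      duhamelScalar (A * modeDelta i₀ i n₀ n) (fun s => TaoCascade.quadTerm ε₀ α X i n (max s 0)) (heatRate ξ) t *
        modeWeight 𝒟 i n ξ)
    (hYV : ∀ (i : Fin m) (n : ℤ), ∀ t ∈ Icc (0 : ℝ) T, Y i n t = ∫ ξ : EuclideanSpace ℝ (Fin 3),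
      duhamelScalar (A * modeDelta i₀ i n₀ n) (fun s => TaoCascade.quadTerm ε₀ α Y i n (max s 0)) (heatRate ξ) t *
        modeWeight 𝒟 i n ξ)
    (hXC : ∀ (i : Fin m) (n : ℤ), ∀ t ∈ Icc (0 : ℝ) T, (1 + ((1 + ε₀) ^ n) ^ 10) * |X i n t| ≤ C)
    (hYC : ∀ (i : Fin m) (n : ℤ), ∀ t ∈ Icc (0 : ℝ) T, (1 + ((1 + ε₀) ^ n) ^ 10) * |Y i n t| ≤ C) :
    ∀ (i : Fin m) (n : ℤ), ∀ t ∈ Icc (0 : ℝ) T, X i n t = Y i n t := by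
  set K : ℝ := ∑ i₃ : Fin m, ∑ i₁ : Fin m, ∑ i₂ : Fin m, ∑ μ ∈ TaoCascade.shiftSet, |α i₁ i₂ i₃ μ| with hK
  have hK0 : 0 ≤ K := by positivity
  have hw0 : ∀ k : ℤ, 0 < 1 + ((1 + ε₀) ^ k) ^ 10 := fun k => by positivity
  set R : ℝ := |C| + 1 with hR
  have hR0 : 0 < R := by positivity
  have hCR : C ≤ R := (le_abs_self C).trans (by linarith)
  have hden : 0 < 2 ^ 23 * K * R + 1 := by nlinarith [mul_nonneg hK0 hR0.le]
  obtain ⟨τ, hτ⟩ : ∃ τ : ℝ, τ = 1 / (2 ^ 23 * K * R + 1) := ⟨_, rfl⟩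
  have hτ0 : 0 < τ := by rw [hτ]; exact div_pos one_pos hden
  have hτR : τ * (2 ^ 22 * K * R) ≤ 2⁻¹ := by
    rw [hτ, one_div, inv_mul_le_iff₀ hden]
    nlinarith [mul_nonneg hK0 hR0.le]
  -- induction over the blocks `[kτ, (k+1)τ]`
  have key : ∀ k : ℕ, ∀ (i : Fin m) (n : ℤ), ∀ t ∈ Icc (0 : ℝ) T, t ≤ k * τ → X i n t = Y i n t := by
    intro k
    induction k with
    | zero =>
      intro i n t ht hk
      have ht0 : t = 0 := le_antisymm (by simpa using hk) ht.1
      subst ht0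
      rw [hXV i n 0 ht, hYV i n 0 ht]
      simp only [duhamelScalar_zero]
    | succ k ih =>
      intro i n t ht hk
      have hT0 : 0 ≤ T := ht.1.trans ht.2
      set T₂ : ℝ := min (((k : ℝ) + 1) * τ) T with hT₂
      set T₁ : ℝ := min ((k : ℝ) * τ) T₂ with hT₁
      have hT₂T : T₂ ≤ T := min_le_right _ _
      have hT₁₂ : T₁ ≤ T₂ := min_le_right _ _
      have hT₁0 : 0 ≤ T₁ := le_min (by positivity) (le_min (by positivity) hT0)
      have hlen : T₂ - T₁ ≤ τ := by
        rcases min_cases ((k : ℝ) * τ) T₂ with ⟨h1, -⟩ | ⟨h1, -⟩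
        · rw [hT₁, h1]; linarith [min_le_left (((k : ℝ) + 1) * τ) T]
        · rw [hT₁, h1]; linarith
      have hist : ∀ (j : Fin m) (l : ℤ), ∀ s ∈ Icc (0 : ℝ) T₁, X j l s = Y j l s := fun j l s hs =>
        ih j l s ⟨hs.1, hs.2.trans (hT₁₂.trans hT₂T)⟩ (hs.2.trans (min_le_left _ _))
      -- geometric decay of the difference on `[0,T₂]`
      have dec : ∀ j' : ℕ, ∀ (j : Fin m) (l : ℤ), ∀ s ∈ Icc (0 : ℝ) T₂,
          (1 + ((1 + ε₀) ^ l) ^ 10) * |X j l s - Y j l s| ≤ 2 * R / 2 ^ j' := by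
        intro j'
        induction j' with
        | zero =>
          intro j l s hs
          have hs' : s ∈ Icc (0 : ℝ) T := ⟨hs.1, hs.2.trans hT₂T⟩
          rw [pow_zero, div_one]
          calc (1 + ((1 + ε₀) ^ l) ^ 10) * |X j l s - Y j l s|
              ≤ (1 + ((1 + ε₀) ^ l) ^ 10) * |X j l s| + (1 + ((1 + ε₀) ^ l) ^ 10) * |Y j l s| := by
                rw [← mul_add]; exact mul_le_mul_of_nonneg_left (abs_sub _ _) (hw0 l).le
            _ ≤ C + C := add_le_add (hXC j l s hs') (hYC j l s hs')
            _ ≤ 2 * R := by linarith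
        | succ j' ihj =>
          intro j l s hs
          rcases le_or_gt s T₁ with hs1 | hs1
          · rw [hist j l s ⟨hs.1, hs1⟩, sub_self, abs_zero, mul_zero]; positivity
          · have hs' : s ∈ Icc (0 : ℝ) T := ⟨hs.1, hs.2.trans hT₂T⟩
            rw [hXV j l s hs', hYV j l s hs']
            have h := volterra_sub_le hε₀ hε₁ 𝒟 α (A * modeDelta i₀ j n₀ l) hXc hYc hT₁0 hT₁₂ (R := R) (D := 2 * R / 2 ^ j')
              (fun a b r hr => (hXC a b r ⟨hr.1, hr.2.trans hT₂T⟩).trans hCR)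
              (fun a b r hr => (hYC a b r ⟨hr.1, hr.2.trans hT₂T⟩).trans hCR) ihj hist j l ⟨hs1.le, hs.2⟩
            refine h.trans ?_
            calc (T₂ - T₁) * (2 ^ 22 * K * R * (2 * R / 2 ^ j'))
                ≤ τ * (2 ^ 22 * K * R * (2 * R / 2 ^ j')) := mul_le_mul_of_nonneg_right hlen (by positivity)
              _ = τ * (2 ^ 22 * K * R) * (2 * R / 2 ^ j') := by ring
              _ ≤ 2⁻¹ * (2 * R / 2 ^ j') := mul_le_mul_of_nonneg_right hτR (by positivity)
              _ = 2 * R / 2 ^ (j' + 1) := by rw [pow_succ]; field_simp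
      have htT₂ : t ∈ Icc (0 : ℝ) T₂ := ⟨ht.1, le_min (by push_cast at hk; linarith) ht.2⟩
      have h0 : (1 + ((1 + ε₀) ^ n) ^ 10) * |X i n t - Y i n t| ≤ 0 := by
        refine le_of_forall_pos_le_add fun ε hε' => ?_
        obtain ⟨j', hj'⟩ := pow_unbounded_of_one_lt (2 * R / ε) (by norm_num : (1 : ℝ) < 2)
        refine (dec j' i n t htT₂).trans ?_
        rw [zero_add, div_le_iff₀ (by positivity)]
        rw [div_lt_iff₀ hε'] at hj'
        linarith
      have h1 : |X i n t - Y i n t| ≤ 0 := by nlinarith [hw0 n, abs_nonneg (X i n t - Y i n t)]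
      exact sub_eq_zero.1 (abs_nonpos_iff.1 h1)
  intro i n t ht
  obtain ⟨k, hk⟩ := exists_nat_ge (T / τ)
  exact key k i n t ht (ht.2.trans ((div_le_iff₀ hτ0).1 hk))

/-- **Uniqueness on half-open intervals**: two continuous solutions on `[0,S)` with weighted bounds on every `[0,S']`,
`S' < S`, coincide on `[0,S)` (`volterra_unique` on `[0,t]` for each `t < S`). [cite: Tao2016AveragedNS, §4 Lemma 4.1 (4.14)] -/
theorem volterra_unique_Ico (hε₀ : 0 < ε₀) (hε₁ : ε₀ < 1) (𝒟 : CascadeWaveletData ε₀ m)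
    (α : Fin m → Fin m → Fin m → ℤ × ℤ × ℤ → ℝ) (i₀ : Fin m) (n₀ : ℤ) (A : ℝ) {S : ℝ} {X Y : Fin m → ℤ → ℝ → ℝ}
    (hXc : ∀ (i : Fin m) (n : ℤ), Continuous (X i n)) (hYc : ∀ (i : Fin m) (n : ℤ), Continuous (Y i n))
    (hXV : ∀ (i : Fin m) (n : ℤ), ∀ t ∈ Ico (0 : ℝ) S, X i n t = ∫ ξ : EuclideanSpace ℝ (Fin 3),
      duhamelScalar (A * modeDelta i₀ i n₀ n) (fun s => TaoCascade.quadTerm ε₀ α X i n (max s 0)) (heatRate ξ) t *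
        modeWeight 𝒟 i n ξ)
    (hYV : ∀ (i : Fin m) (n : ℤ), ∀ t ∈ Ico (0 : ℝ) S, Y i n t = ∫ ξ : EuclideanSpace ℝ (Fin 3),
      duhamelScalar (A * modeDelta i₀ i n₀ n) (fun s => TaoCascade.quadTerm ε₀ α Y i n (max s 0)) (heatRate ξ) t *
        modeWeight 𝒟 i n ξ)
    (hXB : ∀ S' ∈ Ico (0 : ℝ) S, ∃ C : ℝ, ∀ (i : Fin m) (n : ℤ), ∀ t ∈ Icc (0 : ℝ) S', (1 + ((1 + ε₀) ^ n) ^ 10) * |X i n t| ≤ C)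
    (hYB : ∀ S' ∈ Ico (0 : ℝ) S, ∃ C : ℝ, ∀ (i : Fin m) (n : ℤ), ∀ t ∈ Icc (0 : ℝ) S', (1 + ((1 + ε₀) ^ n) ^ 10) * |Y i n t| ≤ C) :
    ∀ (i : Fin m) (n : ℤ), ∀ t ∈ Ico (0 : ℝ) S, X i n t = Y i n t := by
  intro i n t ht
  obtain ⟨CX, hCX⟩ := hXB t ht
  obtain ⟨CY, hCY⟩ := hYB t ht
  exact volterra_unique hε₀ hε₁ 𝒟 α i₀ n₀ A (C := max CX CY) hXc hYc (fun j k r hr => hXV j k r ⟨hr.1, hr.2.trans_lt ht.2⟩)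
    (fun j k r hr => hYV j k r ⟨hr.1, hr.2.trans_lt ht.2⟩) (fun j k r hr => (hCX j k r hr).trans (le_max_left _ _))
    (fun j k r hr => (hCY j k r hr).trans (le_max_right _ _)) i n t ⟨ht.1, le_rfl⟩

end Literature.Analysis.FluidPDE.Tao2016

end
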